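import Mathlib
import Summits.KontsevichZagierPeriods.KontsevichZagierPeriods.Theorems.SoloInformedBoxCube
import Summits.KontsevichZagierPeriods.KontsevichZagierPeriods.Theorems.SoloInformedHesseChart
import Literature.NumberTheory.Transcendental.KZCalculus
import Literature.NumberTheory.Transcendental.SemialgebraicMapsProofs
import HarnessLib
import HarnessLib.Audit

/-!
# SoloInformed — Gauss triplication by the moves, VIII: the box-to-pencil chart `Φ : H₁ → B₃′`

The rational map
`Φ(X, Y) = ( −(X−Y)²/(3XY),  X²(1−Y³)/(3Y(X−Y)) )`
sends the half box `H₁ = {0 < X < Y < 1}` bijectively onto the outer Hesse region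
`B₃′ = {x < 0, y < 0, xy(1−x−y) < 1/27}`, with
`F∘Φ = xy(1−x−y)∘Φ = (1−X³)(1−Y³)/27` and `|det DΦ| = (X+Y)/3` (`soloInformed_boxChart`).
(Behind it: the fibre `{c = const}` of the box is the Bolza-type curve `r² = t⁶ − 2(1−2c)t³ + 1`,
`t = X/Y`, whose quotient by `t ↦ 1/t` is the Hesse cubic at level `F = c/27`; `x = (2 − t − 1/t)/3`.)
The inverse is explicit: `t + 1/t = 2 − 3x`, `Y³ = 1 − 3(1−t)(−y)/t²`, `X = tY`.

Residency `solo-KontsevichZagierPeriods-informed` (s71); paper §7 (c6)(x).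
References: Kontsevich–Zagier, *Periods* (2001), §1.2 rule (2).
-/

noncomputable section

open MeasureTheory Set Filter
namespace Summit.KontsevichZagierPeriods.KontsevichZagierPeriods.Theorems

open Literature.NumberTheory.Transcendental Literature.NumberTheory.Transcendental.KZ
open Literature.ModelTheory.ExponentialFields

/-! ### The map and its Jacobian: algebra -/

/-- `Φ₁(X,Y) = −(X−Y)²/(3XY)`. [this work] -/
def soloInformedPhiX (X Y : ℝ) : ℝ := -(X - Y) ^ 2 / (3 * X * Y)

/-- `Φ₂(X,Y) = X²(1−Y³)/(3Y(X−Y))`. [this work] -/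
def soloInformedPhiY (X Y : ℝ) : ℝ := X ^ 2 * (1 - Y ^ 3) / (3 * Y * (X - Y))

/-- `∂Φ₁/∂X`. [this work] -/
def soloInformedPhiJ11 (X Y : ℝ) : ℝ := -((X - Y) * (X + Y)) / (3 * X ^ 2 * Y)
/-- `∂Φ₁/∂Y`. [this work] -/
def soloInformedPhiJ12 (X Y : ℝ) : ℝ := (X - Y) * (X + Y) / (3 * X * Y ^ 2)
/-- `∂Φ₂/∂X`. [this work] -/
def soloInformedPhiJ21 (X Y : ℝ) : ℝ := X * (1 - Y ^ 3) * (X - 2 * Y) / (3 * Y * (X - Y) ^ 2)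
/-- `∂Φ₂/∂Y`. [this work] -/
def soloInformedPhiJ22 (X Y : ℝ) : ℝ := -(X ^ 2 * (2 * X * Y ^ 3 - Y ^ 4 + X - 2 * Y)) / (3 * Y ^ 2 * (X - Y) ^ 2)

/-- **`det DΦ = (X+Y)/3`.** [this work] -/
theorem soloInformed_phiJ_det {X Y : ℝ} (hX : X ≠ 0) (hY : Y ≠ 0) (hd : X - Y ≠ 0) :
    soloInformedPhiJ11 X Y * soloInformedPhiJ22 X Y - soloInformedPhiJ12 X Y * soloInformedPhiJ21 X Y =
      (X + Y) / 3 := by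
  unfold soloInformedPhiJ11 soloInformedPhiJ12 soloInformedPhiJ21 soloInformedPhiJ22
  field_simp
  ring

/-- **`F∘Φ = c/27`**: `Φ₁Φ₂(1−Φ₁−Φ₂) = (1−X³)(1−Y³)/27`. [this work] -/
theorem soloInformed_hesseF_phi {X Y : ℝ} (hX : X ≠ 0) (hY : Y ≠ 0) (hd : X - Y ≠ 0) :
    soloInformedPhiX X Y * soloInformedPhiY X Y * (1 - soloInformedPhiX X Y - soloInformedPhiY X Y) =
      (1 - X ^ 3) * (1 - Y ^ 3) / 27 := by
  unfold soloInformedPhiX soloInformedPhiY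
  field_simp
  ring

/-- The chart as a self-map of `ℝ²`. [this work] -/
def soloInformedPhi (Z : Fin 2 → ℝ) : Fin 2 → ℝ := ![soloInformedPhiX (Z 0) (Z 1), soloInformedPhiY (Z 0) (Z 1)]

/-- Its Jacobian matrix as a continuous linear map. [this work] -/
def soloInformedPhiD (Z : Fin 2 → ℝ) : (Fin 2 → ℝ) →L[ℝ] (Fin 2 → ℝ) :=
  LinearMap.toContinuousLinearMap (Matrix.toLin'
    !![soloInformedPhiJ11 (Z 0) (Z 1), soloInformedPhiJ12 (Z 0) (Z 1);
       soloInformedPhiJ21 (Z 0) (Z 1), soloInformedPhiJ22 (Z 0) (Z 1)])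

/-- First component of `Φ`. [this work] -/
theorem soloInformedPhi_zero (Z : Fin 2 → ℝ) : soloInformedPhi Z 0 = soloInformedPhiX (Z 0) (Z 1) := rfl
/-- Second component of `Φ`. [this work] -/
theorem soloInformedPhi_one (Z : Fin 2 → ℝ) : soloInformedPhi Z 1 = soloInformedPhiY (Z 0) (Z 1) := rfl

/-- First row of `DΦ`. [this work] -/
theorem soloInformedPhiD_apply_zero (Z v : Fin 2 → ℝ) :
    soloInformedPhiD Z v 0 = soloInformedPhiJ11 (Z 0) (Z 1) * v 0 + soloInformedPhiJ12 (Z 0) (Z 1) * v 1 := by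
  change Matrix.toLin' !![soloInformedPhiJ11 (Z 0) (Z 1), soloInformedPhiJ12 (Z 0) (Z 1);
    soloInformedPhiJ21 (Z 0) (Z 1), soloInformedPhiJ22 (Z 0) (Z 1)] v 0 = _
  rw [Matrix.toLin'_apply]
  simp [Matrix.mulVec, dotProduct, Fin.sum_univ_two]

/-- Second row of `DΦ`. [this work] -/
theorem soloInformedPhiD_apply_one (Z v : Fin 2 → ℝ) :
    soloInformedPhiD Z v 1 = soloInformedPhiJ21 (Z 0) (Z 1) * v 0 + soloInformedPhiJ22 (Z 0) (Z 1) * v 1 := by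
  change Matrix.toLin' !![soloInformedPhiJ11 (Z 0) (Z 1), soloInformedPhiJ12 (Z 0) (Z 1);
    soloInformedPhiJ21 (Z 0) (Z 1), soloInformedPhiJ22 (Z 0) (Z 1)] v 1 = _
  rw [Matrix.toLin'_apply]
  simp [Matrix.mulVec, dotProduct, Fin.sum_univ_two]

/-- `det DΦ` in terms of the Jacobian entries. [this work] -/
theorem soloInformedPhiD_det (Z : Fin 2 → ℝ) :
    (soloInformedPhiD Z).det = soloInformedPhiJ11 (Z 0) (Z 1) * soloInformedPhiJ22 (Z 0) (Z 1) -
      soloInformedPhiJ12 (Z 0) (Z 1) * soloInformedPhiJ21 (Z 0) (Z 1) := by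
  change LinearMap.det (Matrix.toLin' !![soloInformedPhiJ11 (Z 0) (Z 1), soloInformedPhiJ12 (Z 0) (Z 1);
    soloInformedPhiJ21 (Z 0) (Z 1), soloInformedPhiJ22 (Z 0) (Z 1)]) = _
  rw [LinearMap.det_toLin', Matrix.det_fin_two]
  simp

/-! ### The chart: analysis -/

/-- `Φ` is `ℚ`-semialgebraic (rational) on `H₁`. [this work] -/
theorem soloInformed_isSemialgebraicMapOn_phi : IsSemialgebraicMapOn ℚ soloInformedH1 soloInformedPhi := by
  have hH := soloInformed_isSemialgebraic_H1
  refine IsSemialgebraicMapOn.of_forall hH (Fin.forall_fin_two.mpr ⟨?_, ?_⟩)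
  · refine (isSemialgebraicFunOn_aeval_div_aeval hH (-(MvPolynomial.X 0 - MvPolynomial.X 1) ^ 2)
      (MvPolynomial.C 3 * MvPolynomial.X 0 * MvPolynomial.X 1) fun Z hZ => ?_).congr fun Z _ => ?_
    · obtain ⟨h0, h1, -⟩ := hZ
      have hy : 0 < Z 1 := h0.trans h1
      have : (3 : ℝ) * Z 0 * Z 1 ≠ 0 := by positivity
      simpa using this
    · simp [soloInformedPhi_zero, soloInformedPhiX]
  · refine (isSemialgebraicFunOn_aeval_div_aeval hH (MvPolynomial.X 0 ^ 2 * (1 - MvPolynomial.X 1 ^ 3))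
      (MvPolynomial.C 3 * MvPolynomial.X 1 * (MvPolynomial.X 0 - MvPolynomial.X 1)) fun Z hZ => ?_).congr
      fun Z _ => ?_
    · obtain ⟨h0, h1, -⟩ := hZ
      have hy : 0 < Z 1 := h0.trans h1
      have hd : Z 0 - Z 1 ≠ 0 := by intro h; linarith
      have : (3 : ℝ) * Z 1 * (Z 0 - Z 1) ≠ 0 := mul_ne_zero (by positivity) hd
      simpa using this
    · simp [soloInformedPhi_one, soloInformedPhiY]

/-- `Φ` is differentiable off the axes and the diagonal, with derivative `J`. [this work] -/
theorem soloInformed_hasFDerivAt_phi {Z : Fin 2 → ℝ} (hX : Z 0 ≠ 0) (hY : Z 1 ≠ 0) (hd : Z 0 - Z 1 ≠ 0) :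
    HasFDerivAt soloInformedPhi (soloInformedPhiD Z) Z := by
  have h0 : HasFDerivAt (fun y : Fin 2 → ℝ => y 0)
      (ContinuousLinearMap.proj (R := ℝ) (φ := fun _ : Fin 2 => ℝ) 0) Z := hasFDerivAt_apply 0 Z
  have h1 : HasFDerivAt (fun y : Fin 2 → ℝ => y 1)
      (ContinuousLinearMap.proj (R := ℝ) (φ := fun _ : Fin 2 => ℝ) 1) Z := hasFDerivAt_apply 1 Z
  have hdd := h0.fun_sub h1
  rw [hasFDerivAt_pi']
  refine Fin.forall_fin_two.mpr ⟨?_, ?_⟩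
  · have hN := (hdd.fun_mul hdd).fun_neg
    have hQ := (h0.const_mul (3:ℝ)).fun_mul h1
    have hQz : 3 * Z 0 * Z 1 ≠ 0 := mul_ne_zero (mul_ne_zero three_ne_zero hX) hY
    have h := soloInformed_hasFDerivAt_div hN hQ hQz
    have e : (fun y : Fin 2 → ℝ => soloInformedPhi y 0) =
        fun y => -((y 0 - y 1) * (y 0 - y 1)) / (3 * y 0 * y 1) := by
      funext y; rw [soloInformedPhi_zero, soloInformedPhiX, sq]
    rw [e]
    refine h.congr_fderiv (ContinuousLinearMap.ext fun v => ?_)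
    simp only [ContinuousLinearMap.coe_comp, Function.comp_apply, ContinuousLinearMap.proj_apply,
      soloInformedPhiD_apply_zero, add_apply, smul_apply, FunLike.coe_sub, Pi.sub_apply, neg_apply,
      smul_eq_mul]
    unfold soloInformedPhiJ11 soloInformedPhiJ12
    field_simp
    ring
  · have hN := (h0.fun_mul h0).fun_mul ((h1.fun_mul (h1.fun_mul h1)).const_sub (1:ℝ))
    have hQ := ((h1.const_mul (3:ℝ)).fun_mul hdd)
    have hQz : 3 * Z 1 * (Z 0 - Z 1) ≠ 0 := mul_ne_zero (by positivity) hd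
    have h := soloInformed_hasFDerivAt_div hN hQ hQz
    have e : (fun y : Fin 2 → ℝ => soloInformedPhi y 1) =
        fun y => y 0 * y 0 * (1 - y 1 * (y 1 * y 1)) / (3 * y 1 * (y 0 - y 1)) := by
      funext y; rw [soloInformedPhi_one, soloInformedPhiY]; ring
    rw [e]
    refine h.congr_fderiv (ContinuousLinearMap.ext fun v => ?_)
    simp only [ContinuousLinearMap.coe_comp, Function.comp_apply, ContinuousLinearMap.proj_apply,
      soloInformedPhiD_apply_one, add_apply, smul_apply, FunLike.coe_sub, Pi.sub_apply, neg_apply, smul_eq_mul]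
    unfold soloInformedPhiJ21 soloInformedPhiJ22
    field_simp
    ring

/-- **`Φ` is injective on `H₁`**: `Φ₁` fixes the ratio `t = X/Y` (`t + 1/t = 2 − 3Φ₁`), then `Φ₂`
is strictly monotone in `Y` along the ray. [this work] -/
theorem soloInformed_injOn_phi : InjOn soloInformedPhi soloInformedH1 := by
  intro Z hZ Z' hZ' h
  obtain ⟨hx, hxy, hy1⟩ := hZ
  obtain ⟨hx', hxy', hy1'⟩ := hZ'
  have hy : 0 < Z 1 := hx.trans hxy
  have hy' : 0 < Z' 1 := hx'.trans hxy'
  have hd : Z 0 - Z 1 ≠ 0 := by intro e; linarith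
  have hd' : Z' 0 - Z' 1 ≠ 0 := by intro e; linarith
  have e1 : soloInformedPhiX (Z 0) (Z 1) = soloInformedPhiX (Z' 0) (Z' 1) := by
    have := congrFun h 0; rwa [soloInformedPhi_zero, soloInformedPhi_zero] at this
  have e2 : soloInformedPhiY (Z 0) (Z 1) = soloInformedPhiY (Z' 0) (Z' 1) := by
    have := congrFun h 1; rwa [soloInformedPhi_one, soloInformedPhi_one] at this
  -- ratio: X Y' = X' Y
  have hp : Z 0 * Z' 1 = Z' 0 * Z 1 := by
    unfold soloInformedPhiX at e1
    rw [div_eq_div_iff (by positivity) (by positivity)] at e1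
    have key : (Z 0 * Z' 1 - Z' 0 * Z 1) * (Z 0 * Z' 0 - Z 1 * Z' 1) = 0 := by linear_combination (-1/3 : ℝ) * e1
    rcases mul_eq_zero.1 key with k | k
    · linarith
    · exfalso
      have : Z 0 * Z' 0 < Z 1 * Z' 1 := mul_lt_mul'' hxy hxy' hx.le hx'.le
      linarith
  -- along the ray: t = X/Y
  set t := Z 0 / Z 1 with ht
  have ht0 : 0 < t := div_pos hx hy
  have ht1 : t - 1 ≠ 0 := by
    intro e; have : t = 1 := by linarith
    rw [ht, div_eq_one_iff_eq hy.ne'] at this; linarith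
  have hX : Z 0 = t * Z 1 := by rw [ht]; field_simp
  have hX' : Z' 0 = t * Z' 1 := by
    rw [ht]; field_simp; linarith [hp]
  have side : ∀ Y : ℝ, Y ≠ 0 → soloInformedPhiY (t * Y) Y = t ^ 2 / (3 * (t - 1)) * (1 - Y ^ 3) := by
    intro Y hY
    unfold soloInformedPhiY
    have : t * Y - Y = Y * (t - 1) := by ring
    rw [this]
    field_simp
  rw [hX, hX', side _ hy.ne', side _ hy'.ne'] at e2
  have hc : t ^ 2 / (3 * (t - 1)) ≠ 0 := div_ne_zero (by positivity) (mul_ne_zero three_ne_zero ht1)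
  have e3 : Z 1 ^ 3 = Z' 1 ^ 3 := by
    have := mul_left_cancel₀ hc e2; linarith
  have eY : Z 1 = Z' 1 := (pow_left_inj₀ hy.le hy'.le (by norm_num)).1 e3
  funext i
  fin_cases i
  · show Z 0 = Z' 0
    rw [hX, hX', eY]
  · exact eY

/-- The tangent-value identity: at `x = −(1−t)²/(3t)`, `v₀ = t²/(3(1−t))`,
`(−x)·v₀·(1 − x + v₀) = 1/27` (the level `F = 1/27` on the ray). [this work] -/
theorem soloInformed_ray_level {t : ℝ} (ht0 : t ≠ 0) (ht1 : 1 - t ≠ 0) :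
    (1 - t) ^ 2 / (3 * t) * (t ^ 2 / (3 * (1 - t))) * (1 + (1 - t) ^ 2 / (3 * t) + t ^ 2 / (3 * (1 - t))) =
      1 / 27 := by
  field_simp
  ring

/-- **`Φ(H₁) = B₃′`.** [this work] -/
theorem soloInformed_image_phi : soloInformedPhi '' soloInformedH1 = soloInformedB3 := by
  ext w
  constructor
  · rintro ⟨Z, ⟨hx, hxy, hy1⟩, rfl⟩
    have hy : 0 < Z 1 := hx.trans hxy
    have hdn : Z 0 - Z 1 < 0 := by linarith
    have hc0 : Z 0 ^ 3 < 1 := pow_lt_one₀ hx.le (hxy.trans hy1) (by norm_num)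
    have hc1 : Z 1 ^ 3 < 1 := pow_lt_one₀ hy.le hy1 (by norm_num)
    refine ⟨?_, ?_, ?_⟩
    · rw [soloInformedPhi_zero, soloInformedPhiX]
      exact div_neg_of_neg_of_pos (by nlinarith [sq_nonneg (Z 0 - Z 1), sq_pos_of_ne_zero hdn.ne]) (by positivity)
    · rw [soloInformedPhi_one, soloInformedPhiY]
      exact div_neg_of_pos_of_neg (by nlinarith [pow_pos hx 2]) (by nlinarith)
    · rw [soloInformedPhi_zero, soloInformedPhi_one, soloInformed_hesseF_phi hx.ne' hy.ne' hdn.ne]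
      have : (1 - Z 0 ^ 3) * (1 - Z 1 ^ 3) < 1 := by nlinarith [pow_pos hx 3, pow_pos hy 3]
      linarith
  · rintro ⟨hwx, hwy, hwF⟩
    -- the ratio t ∈ (0,1) with t + 1/t = 2 - 3x
    set u := 2 - 3 * w 0 with hu
    have hu2 : 2 < u := by rw [hu]; linarith
    set r := Real.sqrt (u ^ 2 - 4) with hr
    have hr0 : 0 ≤ r := Real.sqrt_nonneg _
    have hr2 : r ^ 2 = u ^ 2 - 4 := Real.sq_sqrt (by nlinarith)
    have hru : r < u := by nlinarith
    have hru' : u - 2 < r := by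
      rw [hr]; refine (Real.lt_sqrt (by linarith)).2 (by nlinarith)
    set t := (u - r) / 2 with htdef
    have ht0 : 0 < t := by rw [htdef]; linarith
    have ht1 : t < 1 := by rw [htdef]; linarith
    have htq : t ^ 2 + 1 = u * t := by rw [htdef]; nlinarith [hr2]
    have hxt : w 0 = -(1 - t) ^ 2 / (3 * t) := by
      field_simp
      have : u = 2 - 3 * w 0 := hu
      nlinarith [htq]
    -- the height: Y³ = 1 - q, q = 3(t-1)y/t²
    set q := 3 * (t - 1) * w 1 / t ^ 2 with hq
    have hq0 : 0 < q := by
      rw [hq]; exact div_pos (by nlinarith) (by positivity)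
    have hq1 : q < 1 := by
      -- otherwise F ≥ 1/27 by monotonicity of v ↦ (−x) v (1 − x + v)
      by_contra hle
      push Not at hle
      set v := -w 1 with hv
      set v₀ := t ^ 2 / (3 * (1 - t)) with hv₀
      have hv0 : v₀ ≤ v := by
        rw [hv₀, div_le_iff₀ (by nlinarith)]
        rw [hq, le_div_iff₀ (by positivity)] at hle
        nlinarith
      have hxpos : 0 < -w 0 := by linarith
      have hlev : (-w 0) * v₀ * (1 - w 0 + v₀) = 1 / 27 := by
        rw [hxt, hv₀, neg_div, neg_neg, sub_neg_eq_add]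
        exact soloInformed_ray_level ht0.ne' (by linarith)
      have hmono : (-w 0) * v₀ * (1 - w 0 + v₀) ≤ (-w 0) * v * (1 - w 0 + v) := by
        have : (-w 0) * v * (1 - w 0 + v) - (-w 0) * v₀ * (1 - w 0 + v₀) =
            (-w 0) * (v - v₀) * (1 - w 0 + v + v₀) := by ring
        have hv₀pos : 0 < v₀ := by rw [hv₀]; exact div_pos (by positivity) (by nlinarith)
        nlinarith [mul_nonneg (mul_nonneg hxpos.le (sub_nonneg.2 hv0)) (by nlinarith : (0:ℝ) ≤ 1 - w 0 + v + v₀)]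
      have : w 0 * w 1 * (1 - w 0 - w 1) = (-w 0) * v * (1 - w 0 + v) := by rw [hv]; ring
      linarith
    set Y := (1 - q) ^ (((3:ℕ):ℝ)⁻¹) with hY
    have hY0 : 0 < Y := Real.rpow_pos_of_pos (by linarith) _
    have hY1 : Y < 1 := Real.rpow_lt_one (by linarith) (by linarith) (by norm_num)
    have hY3 : Y ^ 3 = 1 - q := Real.rpow_inv_natCast_pow (by linarith) (by norm_num)
    refine ⟨![t * Y, Y], ⟨by simpa using mul_pos ht0 hY0, by simpa using mul_lt_of_lt_one_left hY0 ht1,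
      by simpa using hY1⟩, ?_⟩
    funext i
    fin_cases i
    · show soloInformedPhi ![t * Y, Y] 0 = w 0
      rw [soloInformedPhi_zero, hxt]
      simp only [Matrix.cons_val_zero, Matrix.cons_val_one, soloInformedPhiX]
      have : t * Y - Y = -(Y * (1 - t)) := by ring
      rw [this, neg_sq]
      field_simp
    · show soloInformedPhi ![t * Y, Y] 1 = w 1
      rw [soloInformedPhi_one]
      simp only [Matrix.cons_val_zero, Matrix.cons_val_one, soloInformedPhiY, hY3, hq]
      have : t * Y - Y = Y * (t - 1) := by ring
      rw [this]
      have ht1' : t - 1 ≠ 0 := by intro e; linarith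
      field_simp
      ring

/-- On `H₁`, `|det DΦ| = (X+Y)/3`. [this work] -/
theorem soloInformed_abs_det_phiD {Z : Fin 2 → ℝ} (hZ : Z ∈ soloInformedH1) :
    |(soloInformedPhiD Z).det| = (Z 0 + Z 1) / 3 := by
  obtain ⟨hx, hxy, -⟩ := hZ
  rw [soloInformedPhiD_det, soloInformed_phiJ_det hx.ne' (by linarith) (by intro e; linarith)]
  exact abs_of_pos (by linarith)

/-- **The box-to-pencil chart.** `Φ : H₁ → B₃′` is a `ℚ`-semialgebraic bijection, differentiable with
`|det DΦ| = (X+Y)/3`, and `F∘Φ = (1−X³)(1−Y³)/27`. [this work] -/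
theorem soloInformed_boxChart :
    IsSemialgebraicMapOn ℚ soloInformedH1 soloInformedPhi ∧
      (∀ Z ∈ soloInformedH1, HasFDerivAt soloInformedPhi (soloInformedPhiD Z) Z) ∧
      InjOn soloInformedPhi soloInformedH1 ∧ soloInformedPhi '' soloInformedH1 = soloInformedB3 ∧
      (∀ Z ∈ soloInformedH1, |(soloInformedPhiD Z).det| = (Z 0 + Z 1) / 3) :=
  ⟨soloInformed_isSemialgebraicMapOn_phi,
    fun Z ⟨hx, hxy, _⟩ => soloInformed_hasFDerivAt_phi hx.ne' (by linarith) (by intro e; linarith),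
    soloInformed_injOn_phi, soloInformed_image_phi, fun _ hZ => soloInformed_abs_det_phiD hZ⟩

end Summit.KontsevichZagierPeriods.KontsevichZagierPeriods.Theorems
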